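import Mathlib
import Summits.AtomisticToContinuum.Crystallization.Theses.PhononSlackCertificates
import Summits.AtomisticToContinuum.Crystallization.Theorems.ChargedEnergyGap.Negative.Unconditional
import Summits.AtomisticToContinuum.Crystallization.Theorems.ThreeConeCertificateOnePercentCertificateFccRung
import Literature.MathematicalPhysics.StatisticalMechanics.LennardJonesClusters

/-!
# Crux `PhononSlackCertificates.NearFarGlueR` (stmt-AtomisticToContinuum-14970), line `Sketch`:
the removal principle and the LOOSE-PARTICLE species of the residual (lattice-free, `e*`-free)

Continuation lead c3.  The registered residual of the line is the tight contact gap (every bad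
particle next to good crystal pays `g₂(δ) > 0` against `N·e*`, `e* = ⨅_Q e(Q)` UNKNOWN).  The tree
holds exactly three handles on `e*`: periodisation `N·e* ≤ 𝓔(y)` (`card_mul_eStar_le`), the trivial
`e* ≤ e(Q)` (`eStar_le`), and the certified bound `e* ≤ e(fcc_{√(19/20)}) ≤ −0.711`
(`energyPerParticle_fccPC_aF_le`).  This file turns the first two into the

* **removal principle** (`removal_principle`): for every finite injective `x`, every set `W` of its
  particles and every periodic `Q`,
  `N·e* + [cross(W, Wᶜ) + ½·double(W)] ≤ 𝓔(x) + #W·e(Q)`, where the bracket is the binding of `W`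
  to the rest plus the self-energy of `W`, i.e. `𝓔(x) − 𝓔(x|Wᶜ)`.  Only the direction `e* ≤ e(Q)`
  is used, so no value of `e*` enters;

and derives from it a species of the residual / of the target `CoerciveTwoShellGap` that no
earlier pass priced and that needs NO reference lattice: **loose particles pay**
(`loose_gap`, `loose_gap_of_le`): with the half-repulsion site functional
`A_j(x) = Σ_{k ≠ j} (min(V,0) + ½·max(V,0))(|x_j − x_k|)`,

  `N·e* + g₀ · #W ≤ 𝓔_LJ(x)`  whenever  `A_j(x) ≥ −0.711 + g₀` for every `j ∈ W`,

for EVERY finite injective configuration and every `W` (no separation, no goodness, no lattice).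
"Loose" = attractive binding (plus half the repulsion) weaker than `0.711 − g₀ ≈ 8.5` ideal bonds:
vapour, chains and monolayers, adatoms and small ad-islands, surface atoms of small clusters,
porous low-coordination junk, and every over-compressed ("hot") particle — in any environment.
Corollaries in the route's vocabulary: `coerciveTwoShellGap_ineq_of_bad_loose` (the target's
inequality on configurations all of whose bad particles are loose) and
`tightContactGap_ineq_loose` (the residual's inequality restricted to loose tight contacts).

What this does NOT reach (recorded so nobody retries it): strongly bound interface defects —
facet, step and kink atoms (a kink atom of an optimal block returns exactly `2e_kink = e_L`, so no
finite comparison configuration certifies surface energy), vacancy neighbours, strained cages.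
Those need the infinite periodic reference of the lattice-subset identity (c1/c2:
`latticeSubsetGap`, `hcpSubsetGap`, `hcpBoxSubsetGap`) or on-site / phonon convexity applied AT
the interface — the crux-sized part of the residual.  All `[folklore]`.
-/

noncomputable section

namespace Summit.AtomisticToContinuum.Crystallization.Theorems.PhononSlackCertificatesNearFarGlueR

open Literature.MathematicalPhysics.StatisticalMechanics
open Literature.Geometry.DiscreteGeometry
open Summit.AtomisticToContinuum.Crystallization.Theses.PhononSlackCertificates
open Summit.AtomisticToContinuum.Crystallization.Theorems.ChargedEnergyGapNegative
  (eStar card_mul_eStar_le eStar_le)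
open Summit.AtomisticToContinuum.Crystallization.Theorems.OnePercentFccRung
  (aF_ne_zero energyPerParticle_fccPC_aF_le)
open Summit.AtomisticToContinuum.Crystallization.Theorems.LayeredLawsSelectHcp.Negative.FccEnergy
  (fccPC)
open scoped BigOperators

/-! ## §1 The removal principle -/

/-- The cross sum is symmetric: `Σ_{i∈Wᶜ} Σ_{k∈W} V(|x_i − x_k|) = Σ_{i∈W} Σ_{k∈Wᶜ} V(|x_i − x_k|)`.
[folklore] -/
theorem loose_cross_symm {N : ℕ} (x : Fin N → EuclideanSpace ℝ (Fin 3)) (W : Finset (Fin N)) :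
    ∑ i ∈ Wᶜ, ∑ k ∈ W, lennardJones (dist (x i) (x k)) =
      ∑ i ∈ W, ∑ k ∈ Wᶜ, lennardJones (dist (x i) (x k)) := by
  rw [Finset.sum_comm]
  exact Finset.sum_congr rfl fun i _ => Finset.sum_congr rfl fun k _ => by rw [dist_comm]

/-- **Restriction identity**: for an enumeration `f` of `Wᶜ`,
`𝓔(x) = 𝓔(x ∘ f) + Σ_{i∈W}Σ_{k∈Wᶜ} V + ½ Σ_{i∈W}Σ_{k∈W} V` (diagonal terms vanish, `V_LJ(0) = 0`).
[folklore] -/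
theorem interactionEnergy_eq_restrict_add {N K : ℕ} (x : Fin N → EuclideanSpace ℝ (Fin 3))
    (W : Finset (Fin N)) (f : Fin K ↪ Fin N) (hmap : Finset.univ.map f = Wᶜ) :
    interactionEnergy lennardJones x = interactionEnergy lennardJones (x ∘ f) +
      ∑ i ∈ W, ∑ k ∈ Wᶜ, lennardJones (dist (x i) (x k)) +
      (1 / 2 : ℝ) * ∑ i ∈ W, ∑ k ∈ W, lennardJones (dist (x i) (x k)) := by
  have htwo := two_mul_interactionEnergy_eq_sum_sum lennardJones lennardJones_zero x
  have hsplit := sum_sum_eq_add_compl (fun i k => lennardJones (dist (x i) (x k))) W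
  have hsub := sum_sum_map_eq_two_mul_interactionEnergy lennardJones lennardJones_zero x f
  rw [hmap] at hsub
  have hsymm := loose_cross_symm x W
  linarith

/-- **Removal principle.**  For every finite injective configuration `x` of `ℝ³`, every set `W` of
its particles and every periodic configuration `Q`:
`N·e* + [Σ_{i∈W}Σ_{k∉W} V + ½ Σ_{i∈W}Σ_{k∈W} V] ≤ 𝓔_LJ(x) + #W·e(Q)` — the bracket being
`𝓔(x) − 𝓔(x|Wᶜ)`, the binding of `W` to the rest plus its self-energy.  Proof: periodisation on the
sub-configuration `x|Wᶜ` (`(N − #W)·e* ≤ 𝓔(x|Wᶜ)`) and `#W·e* ≤ #W·e(Q)`.  No value of `e*` is used.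
[folklore] -/
theorem removal_principle {N : ℕ} (x : Fin N → EuclideanSpace ℝ (Fin 3))
    (hx : Function.Injective x) (W : Finset (Fin N)) (Q : PeriodicConfiguration 3) :
    (N : ℝ) * (⨅ Q : PeriodicConfiguration 3, Q.energyPerParticle lennardJones) +
        (∑ i ∈ W, ∑ k ∈ Wᶜ, lennardJones (dist (x i) (x k)) +
          (1 / 2 : ℝ) * ∑ i ∈ W, ∑ k ∈ W, lennardJones (dist (x i) (x k))) ≤
      interactionEnergy lennardJones x + (W.card : ℝ) * Q.energyPerParticle lennardJones := by
  classical
  set f := (Wᶜ).orderEmbOfFin rfl with hf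
  have hmap : Finset.univ.map f.toEmbedding = Wᶜ := Finset.map_orderEmbOfFin_univ Wᶜ rfl
  have hid := interactionEnergy_eq_restrict_add x W f.toEmbedding hmap
  have hsubE : ((Wᶜ.card : ℕ) : ℝ) * eStar ≤ interactionEnergy lennardJones (x ∘ f.toEmbedding) :=
    card_mul_eStar_le (hx.comp f.toEmbedding.injective)
  have hcard : ((Wᶜ.card : ℕ) : ℝ) = (N : ℝ) - (W.card : ℝ) := by
    rw [Finset.card_compl, Fintype.card_fin, Nat.cast_sub (by
      simpa using W.card_le_univ)]
  have hQ : (W.card : ℝ) * eStar ≤ (W.card : ℝ) * Q.energyPerParticle lennardJones :=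
    mul_le_mul_of_nonneg_left (eStar_le Q) (Nat.cast_nonneg _)
  rw [hcard] at hsubE
  change (N : ℝ) * eStar + _ ≤ _
  have hcomp : interactionEnergy lennardJones (x ∘ f.toEmbedding) =
      interactionEnergy lennardJones (x ∘ ⇑f) := rfl
  rw [hcomp] at hsubE
  nlinarith [hsubE, hQ, hid]

/-- **Move principle** (recorded for completeness): `N·e* ≤ 𝓔(x')` for every injective `x'` with the
same number of particles, so `𝓔(x) − N·e* ≥ 𝓔(x) − 𝓔(x')` — single-particle or collective moves that
lower the energy certify a gap with NO reference to `e*` at all. [folklore] -/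
theorem move_principle {N : ℕ} (x x' : Fin N → EuclideanSpace ℝ (Fin 3))
    (hx' : Function.Injective x') :
    (N : ℝ) * (⨅ Q : PeriodicConfiguration 3, Q.energyPerParticle lennardJones) +
        (interactionEnergy lennardJones x - interactionEnergy lennardJones x') ≤
      interactionEnergy lennardJones x := by
  have h : (N : ℝ) * eStar ≤ interactionEnergy lennardJones x' := card_mul_eStar_le hx'
  change (N : ℝ) * eStar + _ ≤ _
  linarith

/-! ## §2 Loose particles pay -/

/-- The half-repulsion functional is dominated by the removal bracket:
`Σ_{j∈W} Σ_{k≠j} (V⁻ + ½V⁺) ≤ Σ_{i∈W}Σ_{k∉W} V + ½ Σ_{i∈W}Σ_{k∈W} V`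
(`V⁻ + ½V⁺ ≤ V` across the cut, `V⁻ + ½V⁺ ≤ ½V` inside `W`, the diagonal vanishes). [folklore] -/
theorem loose_sum_le {N : ℕ} (x : Fin N → EuclideanSpace ℝ (Fin 3)) (W : Finset (Fin N)) :
    ∑ j ∈ W, ∑ k ∈ Finset.univ.erase j,
        (min (lennardJones (dist (x j) (x k))) 0 + (1 / 2 : ℝ) * max (lennardJones (dist (x j) (x k))) 0) ≤
      ∑ i ∈ W, ∑ k ∈ Wᶜ, lennardJones (dist (x i) (x k)) +
        (1 / 2 : ℝ) * ∑ i ∈ W, ∑ k ∈ W, lennardJones (dist (x i) (x k)) := by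
  classical
  set φ : Fin N → Fin N → ℝ := fun j k =>
    min (lennardJones (dist (x j) (x k))) 0 + (1 / 2 : ℝ) * max (lennardJones (dist (x j) (x k))) 0
    with hφ
  -- the diagonal term vanishes, so the punctured sum is the full sum
  have hdiag : ∀ j : Fin N, ∑ k ∈ Finset.univ.erase j, φ j k = ∑ k, φ j k := fun j => by
    refine Finset.sum_erase _ ?_
    simp [hφ, dist_self, lennardJones_zero]
  have hsplit : ∀ j : Fin N, ∑ k, φ j k = ∑ k ∈ W, φ j k + ∑ k ∈ Wᶜ, φ j k := fun j =>
    (Finset.sum_add_sum_compl W _).symm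
  have hin : ∀ j k : Fin N, φ j k ≤ (1 / 2 : ℝ) * lennardJones (dist (x j) (x k)) := fun j k => by
    have h1 : min (lennardJones (dist (x j) (x k))) 0 ≤ 0 := min_le_right _ _
    have h2 := min_add_max (lennardJones (dist (x j) (x k))) 0
    simp only [hφ]
    linarith
  have hout : ∀ j k : Fin N, φ j k ≤ lennardJones (dist (x j) (x k)) := fun j k => by
    have h1 : 0 ≤ max (lennardJones (dist (x j) (x k))) 0 := le_max_right _ _
    have h2 := min_add_max (lennardJones (dist (x j) (x k))) 0
    simp only [hφ]
    linarith
  calc ∑ j ∈ W, ∑ k ∈ Finset.univ.erase j, φ j k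
      = ∑ j ∈ W, (∑ k ∈ W, φ j k + ∑ k ∈ Wᶜ, φ j k) :=
        Finset.sum_congr rfl fun j _ => by rw [hdiag, hsplit]
    _ = ∑ j ∈ W, ∑ k ∈ W, φ j k + ∑ j ∈ W, ∑ k ∈ Wᶜ, φ j k := Finset.sum_add_distrib
    _ ≤ ∑ j ∈ W, ∑ k ∈ W, (1 / 2 : ℝ) * lennardJones (dist (x j) (x k)) +
          ∑ j ∈ W, ∑ k ∈ Wᶜ, lennardJones (dist (x j) (x k)) := by
        gcongr with j _ k _ j _ k _
        · exact hin j k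
        · exact hout j k
    _ = ∑ i ∈ W, ∑ k ∈ Wᶜ, lennardJones (dist (x i) (x k)) +
          (1 / 2 : ℝ) * ∑ i ∈ W, ∑ k ∈ W, lennardJones (dist (x i) (x k)) := by
        rw [Finset.mul_sum]
        simp_rw [Finset.mul_sum]
        ring

/-- **Loose particles pay** (general periodic comparison).  For every finite injective `x`, every
periodic `Q`, every `g₀` and every set `W` of particles each of which is `g₀`-loose relative to
`e(Q)` — `A_j(x) = Σ_{k≠j} (V⁻ + ½V⁺)(|x_j − x_k|) ≥ e(Q) + g₀` — one has `N·e* + g₀·#W ≤ 𝓔_LJ(x)`.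
[folklore] -/
theorem loose_gap {N : ℕ} (x : Fin N → EuclideanSpace ℝ (Fin 3)) (hx : Function.Injective x)
    (Q : PeriodicConfiguration 3) (g₀ : ℝ) (W : Finset (Fin N))
    (hW : ∀ j ∈ W, Q.energyPerParticle lennardJones + g₀ ≤
      ∑ k ∈ Finset.univ.erase j,
        (min (lennardJones (dist (x j) (x k))) 0 + (1 / 2 : ℝ) * max (lennardJones (dist (x j) (x k))) 0)) :
    (N : ℝ) * (⨅ Q : PeriodicConfiguration 3, Q.energyPerParticle lennardJones) +
        g₀ * (W.card : ℝ) ≤ interactionEnergy lennardJones x := by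
  have hrem := removal_principle x hx W Q
  have hle := loose_sum_le x W
  have hsum : ∑ j ∈ W, (Q.energyPerParticle lennardJones + g₀) ≤
      ∑ j ∈ W, ∑ k ∈ Finset.univ.erase j,
        (min (lennardJones (dist (x j) (x k))) 0 +
          (1 / 2 : ℝ) * max (lennardJones (dist (x j) (x k))) 0) := Finset.sum_le_sum hW
  rw [Finset.sum_const, nsmul_eq_mul] at hsum
  nlinarith [hrem, hle, hsum]

/-- **Loose particles pay** (numeric threshold).  With the tree's certified
`e(fcc_{√(19/20)}) ≤ −711/1000`: if `A_j(x) ≥ −711/1000 + g₀` for every `j ∈ W` then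
`N·e* + g₀·#W ≤ 𝓔_LJ(x)` — for EVERY finite injective configuration of `ℝ³` (no separation, no
goodness, no lattice hypothesis). [folklore] -/
theorem loose_gap_of_le {N : ℕ} (x : Fin N → EuclideanSpace ℝ (Fin 3)) (hx : Function.Injective x)
    (g₀ : ℝ) (W : Finset (Fin N))
    (hW : ∀ j ∈ W, -(711 / 1000 : ℝ) + g₀ ≤
      ∑ k ∈ Finset.univ.erase j,
        (min (lennardJones (dist (x j) (x k))) 0 + (1 / 2 : ℝ) * max (lennardJones (dist (x j) (x k))) 0)) :
    (N : ℝ) * (⨅ Q : PeriodicConfiguration 3, Q.energyPerParticle lennardJones) +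
        g₀ * (W.card : ℝ) ≤ interactionEnergy lennardJones x :=
  loose_gap x hx (fccPC aF_ne_zero) g₀ W fun j hj =>
    le_trans (by linarith [energyPerParticle_fccPC_aF_le]) (hW j hj)

/-- **Registered sub-goal `stub_looseGap` of the crux item** (skeleton `Lines/Sketch.lean`, c3):
loose particles pay — the statement of `loose_gap_of_le` in closed form. [folklore] -/
theorem stub_looseGap :
    ∀ (N : ℕ) (x : Fin N → EuclideanSpace ℝ (Fin 3)), Function.Injective x →
      ∀ (g₀ : ℝ) (W : Finset (Fin N)),
        (∀ j ∈ W, -(711 / 1000 : ℝ) + g₀ ≤ ∑ k ∈ Finset.univ.erase j,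
          (min (lennardJones (dist (x j) (x k))) 0 +
            (1 / 2 : ℝ) * max (lennardJones (dist (x j) (x k))) 0)) →
        (N : ℝ) * (⨅ Q : PeriodicConfiguration 3, Q.energyPerParticle lennardJones) +
            g₀ * (W.card : ℝ) ≤ interactionEnergy lennardJones x :=
  fun _ x hx g₀ W hW => loose_gap_of_le x hx g₀ W hW

/-! ## §3 In the route's vocabulary -/

/-- **The target's inequality on configurations all of whose bad particles are loose.**  If every
`1/20`-bad particle of the injective configuration `x` is `g₀`-loose (`A_j ≥ −0.711 + g₀`), then
`N·e* + g₀·#bad ≤ 𝓔_LJ(x)` — the body of `CoerciveTwoShellGap` with `g = g₀`, on this class.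
[folklore] -/
theorem coerciveTwoShellGap_ineq_of_bad_loose {N : ℕ} (x : Fin N → EuclideanSpace ℝ (Fin 3))
    (hx : Function.Injective x) (g₀ : ℝ)
    (hloose : ∀ j : Fin N, ¬ IsTwoShellGood (1 / 20) (47 / 50) 1 x j → -(711 / 1000 : ℝ) + g₀ ≤
      ∑ k ∈ Finset.univ.erase j,
        (min (lennardJones (dist (x j) (x k))) 0 + (1 / 2 : ℝ) * max (lennardJones (dist (x j) (x k))) 0)) :
    (N : ℝ) * (⨅ Q : PeriodicConfiguration 3, Q.energyPerParticle lennardJones) +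
        g₀ * (Nat.card {i : Fin N // ¬ IsTwoShellGood (1 / 20) (47 / 50) 1 x i} : ℝ) ≤
      interactionEnergy lennardJones x := by
  classical
  have hcard : (Nat.card {i : Fin N // ¬ IsTwoShellGood (1 / 20) (47 / 50) 1 x i} : ℝ) =
      ((Finset.univ.filter fun i : Fin N => ¬ IsTwoShellGood (1 / 20) (47 / 50) 1 x i).card : ℝ) := by
    rw [Nat.card_eq_fintype_card, Fintype.card_subtype]
  rw [hcard]
  exact loose_gap_of_le x hx g₀ _ fun j hj => hloose j (Finset.mem_filter.1 hj).2

/-- **The residual's inequality restricted to loose tight contacts.**  For every injective `x` and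
every `g₀`: `N·e* + g₀·#{j bad, within 21/20 of a good particle, and g₀-loose} ≤ 𝓔_LJ(x)` — the
loose species of the registered residual `stub_tightContactGap`, unconditionally. [folklore] -/
theorem tightContactGap_ineq_loose {N : ℕ} (x : Fin N → EuclideanSpace ℝ (Fin 3))
    (hx : Function.Injective x) (g₀ : ℝ) :
    (N : ℝ) * (⨅ Q : PeriodicConfiguration 3, Q.energyPerParticle lennardJones) +
        g₀ * (Nat.card {j : Fin N // (¬ IsTwoShellGood (1 / 20) (47 / 50) 1 x j ∧
            ∃ i : Fin N, IsTwoShellGood (1 / 20) (47 / 50) 1 x i ∧ dist (x i) (x j) ≤ 21 / 20) ∧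
          -(711 / 1000 : ℝ) + g₀ ≤ ∑ k ∈ Finset.univ.erase j,
            (min (lennardJones (dist (x j) (x k))) 0 +
              (1 / 2 : ℝ) * max (lennardJones (dist (x j) (x k))) 0)} : ℝ) ≤
      interactionEnergy lennardJones x := by
  classical
  rw [Nat.card_eq_fintype_card, Fintype.card_subtype]
  exact loose_gap_of_le x hx g₀ _ fun j hj => (Finset.mem_filter.1 hj).2.2

end Summit.AtomisticToContinuum.Crystallization.Theorems.PhononSlackCertificatesNearFarGlueR

end
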